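import Literature.NumberTheory.Automorphic.ArchRankinSelbergCornerTestVector
import Literature.NumberTheory.Automorphic.PairLFunctionNeConjLevelOneOfTestVector
import Mathlib.Analysis.SpecialFunctions.Gamma.Deligne

/-!
# The archimedean corner data with their reciprocal entire factor `Λ`

Summit `Langlands`, sub-problem `Langlands`, helper file under `Theorems/` supporting the crux
`PairLBoundaryJS` (stmt-Langlands-13622), line `Sketch`, registered stub `stub_corner_arch_factor_data`
(W-CAFD): the `GL_{m+1} × GL_m` ("corner") analogue of
`Literature.NumberTheory.Automorphic.archPairLFactorData_of_testVector`. From the named fact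
`JacquetArchimedeanRS2009_archRankinSelbergCorner_testVector m K` (Jacquet (2009), Thm. 2.7 (i) with
Thm. 2.1 (i): finitely many `K_∞`-finite Gårding data `e_i`, `e'_i` with
`Σ_i Ψ^corner_∞(s; W_{e_i}, W̄'_{e'_i}) = c^s ∏_j Γ_ℝ(s + a_j) ∏_j Γ_ℂ(s + b_j)` for `re s > x₀`) we produce
the ENTIRE function `Λ(s) = c^{-s} ∏_j Γ_ℝ(s + a_j)⁻¹ ∏_j Γ_ℂ(s + b_j)⁻¹` (`1/Γ` is entire:
`Complex.differentiable_Gammaℝ_inv`, `differentiable_Gammaℂ_inv`) and the abscissa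
`x₁ = max x₀ (Σ_j ‖a_j‖ + Σ_j ‖b_j‖)`, to the right of which every `Γ_ℝ(s + a_j)`, `Γ_ℂ(s + b_j)` is
finite and non-zero (`re (s + a_j) > 0`), so that `Λ(s) · Σ_i Ψ^corner_∞(s; e_i, e'_i) = 1` there.

## References

* H. Jacquet, *Archimedean Rankin–Selberg integrals*, Contemp. Math. 489 (2009), Thm. 2.1 (i),
  Thm. 2.7 (i), §16 [JacquetArchimedeanRS2009].
* J. W. Cogdell, *Analytic theory of L-functions for GL_n* (2004), §3.2, §4.1 [CogdellAnalyticTheory2004].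
-/

noncomputable section

-- `Summit.Langlands.Langlands.…` (summit = sub-problem name, D-0017 layout) trips `dupNamespace`
set_option linter.dupNamespace false

open scoped MatrixGroups Topology Pointwise ENNReal NNReal ComplexConjugate InnerProductSpace ContDiff
-- the place subtypes indexing `mixedSpace K` are `Fintype` classically (`NormedCommRing (mixedSpace K)`)
open scoped Classical Matrix.Norms.Operator
open NumberField IsDedekindDomain MeasureTheory Measure Matrix Set Filter WithZero
open NumberField.mixedEmbedding
open Literature.NumberTheory.Automorphic AdelicGroupData
open Literature.NumberTheory.GaloisRepresentations (ideleGroup HeckeCharacter)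
open Literature.MeasureTheory.Group
open ValuativeRel

namespace Summit.Langlands.Langlands.Theorems.CornerArchFactorData

/-! ### The reciprocal archimedean factor `Λ = c^{-s} ∏ Γ_ℝ(s + a_j)⁻¹ ∏ Γ_ℂ(s + b_j)⁻¹` -/

/-- The reciprocal `Λ = c^{-s} ∏ Γ_ℝ(s + a_j)⁻¹ ∏ Γ_ℂ(s + b_j)⁻¹` of an archimedean `L`-factor, written as
the PRODUCT of the entire functions `c^{-s}`, `Γ_ℝ(s + a_j)⁻¹`, `Γ_ℂ(s + b_j)⁻¹`, is entire for `c ≠ 0`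
(`1/Γ` is entire: `Complex.differentiable_Gammaℝ_inv`, `differentiable_Gammaℂ_inv`). [folklore] -/
theorem differentiable_archFactorInv {c : ℝ} (hc : c ≠ 0) {d₁ d₂ : ℕ} (a : Fin d₁ → ℂ) (b : Fin d₂ → ℂ) :
    Differentiable ℂ fun s : ℂ =>
      (c : ℂ) ^ (-s) * ((∏ j, (Complex.Gammaℝ (s + a j))⁻¹) * ∏ j, (Complex.Gammaℂ (s + b j))⁻¹) := by
  refine (differentiable_id.neg.const_cpow (Or.inl (Complex.ofReal_ne_zero.2 hc))).mul
    ((differentiable_fun_finset_prod _ fun j _ => ?_).mul (differentiable_fun_finset_prod _ fun j _ => ?_))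
  · exact Complex.differentiable_Gammaℝ_inv.comp (differentiable_id.add_const _)
  · exact differentiable_Gammaℂ_inv.comp (differentiable_id.add_const _)

/-- `-‖z‖ ≤ re z`. [folklore] -/
theorem neg_norm_le_re (z : ℂ) : -‖z‖ ≤ z.re := (abs_le.mp (Complex.abs_re_le_norm z)).1

/-- To the right of `Σ_j ‖a_j‖ + Σ_j ‖b_j‖` every shifted argument `s + a_j` has positive real part. [folklore] -/
theorem re_add_pos_of_sum_norm_lt {d₁ d₂ : ℕ} (a : Fin d₁ → ℂ) (b : Fin d₂ → ℂ) {s : ℂ}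
    (hs : (∑ j, ‖a j‖) + ∑ j, ‖b j‖ < s.re) :
    (∀ j, 0 < (s + a j).re) ∧ ∀ j, 0 < (s + b j).re := by
  have ha0 : 0 ≤ ∑ j, ‖a j‖ := Finset.sum_nonneg fun j _ => norm_nonneg _
  have hb0 : 0 ≤ ∑ j, ‖b j‖ := Finset.sum_nonneg fun j _ => norm_nonneg _
  refine ⟨fun j => ?_, fun j => ?_⟩
  · have hj : ‖a j‖ ≤ ∑ j, ‖a j‖ := Finset.single_le_sum (fun j _ => norm_nonneg (a j)) (Finset.mem_univ j)
    rw [Complex.add_re]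
    linarith [neg_norm_le_re (a j)]
  · have hj : ‖b j‖ ≤ ∑ j, ‖b j‖ := Finset.single_le_sum (fun j _ => norm_nonneg (b j)) (Finset.mem_univ j)
    rw [Complex.add_re]
    linarith [neg_norm_le_re (b j)]

/-- **`Λ(s) · (c^s ∏ Γ_ℝ(s + a_j) ∏ Γ_ℂ(s + b_j)) = 1` to the right of `Σ_j ‖a_j‖ + Σ_j ‖b_j‖`** (`c > 0`):
there `re (s + a_j) > 0`, `re (s + b_j) > 0`, so the `Γ`-factors are non-zero
(`Complex.Gammaℝ_ne_zero_of_re_pos`, `Gammaℂ_ne_zero_of_re_pos`). [folklore] -/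
theorem archFactorInv_mul_eq_one {c : ℝ} (hc : 0 < c) {d₁ d₂ : ℕ} (a : Fin d₁ → ℂ) (b : Fin d₂ → ℂ) {s : ℂ}
    (hs : (∑ j, ‖a j‖) + ∑ j, ‖b j‖ < s.re) :
    (c : ℂ) ^ (-s) * ((∏ j, (Complex.Gammaℝ (s + a j))⁻¹) * ∏ j, (Complex.Gammaℂ (s + b j))⁻¹) *
      ((c : ℂ) ^ s * ((∏ j, Complex.Gammaℝ (s + a j)) * ∏ j, Complex.Gammaℂ (s + b j))) = 1 := by
  obtain ⟨ha, hb⟩ := re_add_pos_of_sum_norm_lt a b hs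
  have hcs : (c : ℂ) ^ s ≠ 0 := by
    rw [Ne, Complex.cpow_eq_zero_iff, not_and_or]
    exact Or.inl (Complex.ofReal_ne_zero.2 hc.ne')
  have hΓℝ : ∀ j, Complex.Gammaℝ (s + a j) ≠ 0 := fun j => Complex.Gammaℝ_ne_zero_of_re_pos (ha j)
  have hΓℂ : ∀ j, Complex.Gammaℂ (s + b j) ≠ 0 := fun j => Gammaℂ_ne_zero_of_re_pos (hb j)
  have hcneg : (c : ℂ) ^ (-s) * (c : ℂ) ^ s = 1 := by
    rw [Complex.cpow_neg, inv_mul_cancel₀ hcs]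
  calc (c : ℂ) ^ (-s) * ((∏ j, (Complex.Gammaℝ (s + a j))⁻¹) * ∏ j, (Complex.Gammaℂ (s + b j))⁻¹) *
        ((c : ℂ) ^ s * ((∏ j, Complex.Gammaℝ (s + a j)) * ∏ j, Complex.Gammaℂ (s + b j)))
      = ((c : ℂ) ^ (-s) * (c : ℂ) ^ s) *
          (((∏ j, (Complex.Gammaℝ (s + a j))⁻¹) * ∏ j, Complex.Gammaℝ (s + a j)) *
            ((∏ j, (Complex.Gammaℂ (s + b j))⁻¹) * ∏ j, Complex.Gammaℂ (s + b j))) := by ring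
    _ = 1 := by
      rw [hcneg, ← Finset.prod_mul_distrib, ← Finset.prod_mul_distrib,
        Finset.prod_eq_one fun j _ => inv_mul_cancel₀ (hΓℝ j),
        Finset.prod_eq_one fun j _ => inv_mul_cancel₀ (hΓℂ j)]
      ring

/-! ### The corner data -/

/-- **The archimedean corner data with their reciprocal entire factor** (the corner analogue of
`archPairLFactorData_of_testVector`): granted `JacquetArchimedeanRS2009_archRankinSelbergCorner_testVector m K`,
for irreducible unitary strongly continuous `τ` of `GL_{m+1}(K_∞)`, `τ'` of `GL_m(K_∞)` with non-zero
continuous Whittaker functionals `ℓ`, `ℓ'` and Haar measures `μA`, `μK`, there are finitely many `K_∞`-finite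
Gårding vectors `e_i`, `e'_i`, an ENTIRE `Λ` and an abscissa `x₁` with
`Λ(s) · Σ_i Ψ^corner_∞(s; W_{e_i}, W̄'_{e'_i}) = 1` for `re s > x₁`: take the data of the fact,
`Λ = c^{-s} ∏_j Γ_ℝ(s + a_j)⁻¹ ∏_j Γ_ℂ(s + b_j)⁻¹` and `x₁ = max x₀ (Σ_j ‖a_j‖ + Σ_j ‖b_j‖)`.
[cite: JacquetArchimedeanRS2009, Thm. 2.7 (i) (p. 10) and Thm. 2.1 (i) (p. 6)]
[cite: CogdellAnalyticTheory2004, §3.2 and §4.1] -/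
theorem exists_archCornerFactorData {m : ℕ} {K : Type} [Field K] [NumberField K]
    (h : JacquetArchimedeanRS2009_archRankinSelbergCorner_testVector m K)
    (hcpt : isCompact_glFiniteIntegralLevel (m + 1) K) (hcpt' : isCompact_glFiniteIntegralLevel m K)
    (E : Type) [NormedAddCommGroup E] [InnerProductSpace ℂ E] [CompleteSpace E]
    (τ : ContRepresentation ℂ (AutomorphyDatum.gl (m + 1) K hcpt).arch.carrier E) (hτ : τ.IsStronglyContinuous)
    (hτu : τ.IsUnitary) (hτi : τ.IsTopIrreducible)
    (ℓ : archGardingSpace hcpt τ →ₗ[ℂ] ℂ) (hℓ : IsArchContWhittakerFunctional hcpt τ hτ ℓ) (hℓ0 : ℓ ≠ 0)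
    (E' : Type) [NormedAddCommGroup E'] [InnerProductSpace ℂ E'] [CompleteSpace E']
    (τ' : ContRepresentation ℂ (AutomorphyDatum.gl m K hcpt').arch.carrier E') (hτ' : τ'.IsStronglyContinuous)
    (hτu' : τ'.IsUnitary) (hτi' : τ'.IsTopIrreducible)
    (ℓ' : archGardingSpace hcpt' τ' →ₗ[ℂ] ℂ) (hℓ' : IsArchContWhittakerFunctional hcpt' τ' hτ' ℓ') (hℓ'0 : ℓ' ≠ 0)
    [MeasurableSpace (GL (Fin m) (mixedSpace K))] [BorelSpace (GL (Fin m) (mixedSpace K))]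
    [MeasurableSpace ((mixedSpace K)ˣ)] [BorelSpace ((mixedSpace K)ˣ)]
    (μA : Measure (Fin m → (mixedSpace K)ˣ)) (hμA : IsHaarMeasure μA)
    (μK : Measure ↥(Kinf m K)) (hμK : IsHaarMeasure μK) :
    ∃ (k : ℕ) (e : Fin k → archGardingSpace hcpt τ) (e' : Fin k → archGardingSpace hcpt' τ')
      (_ : ∀ i, FiniteDimensional ℂ (Submodule.span ℂ (Set.range
        fun κ : (AutomorphyDatum.gl (m + 1) K hcpt).arch.maximalCompact =>
          τ (toArch hcpt (κ : GL (Fin (m + 1)) (mixedSpace K))) (e i : E))))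
      (_ : ∀ i, FiniteDimensional ℂ (Submodule.span ℂ (Set.range
        fun κ : (AutomorphyDatum.gl m K hcpt').arch.maximalCompact =>
          τ' (toArch hcpt' (κ : GL (Fin m) (mixedSpace K))) (e' i : E'))))
      (Λ : ℂ → ℂ) (x₀ : ℝ), Differentiable ℂ Λ ∧ ∀ s : ℂ, x₀ < s.re →
        Λ s * ∑ i, archCornerPairIntegralCplx hcpt hcpt' τ hτ τ' hτ' ℓ ℓ' (e i) (e' i) μA μK s = 1 := by
  obtain ⟨⟨k, e, e', hfin, hfin', c, hc, d₁, d₂, a, b, x₀, hΨ⟩, _⟩ :=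
    h hcpt hcpt' E τ hτ hτu hτi ℓ hℓ hℓ0 E' τ' hτ' hτu' hτi' ℓ' hℓ' hℓ'0 μA hμA μK hμK
  refine ⟨k, e, e', hfin, hfin',
    fun s => (c : ℂ) ^ (-s) * ((∏ j, (Complex.Gammaℝ (s + a j))⁻¹) * ∏ j, (Complex.Gammaℂ (s + b j))⁻¹),
    max x₀ ((∑ j, ‖a j‖) + ∑ j, ‖b j‖), differentiable_archFactorInv hc.ne' a b, fun s hs => ?_⟩
  obtain ⟨hs₀, hs₁⟩ := max_lt_iff.1 hs
  rw [hΨ s hs₀]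
  exact archFactorInv_mul_eq_one hc a b hs₁

/-- **Registered stub `stub_corner_arch_factor_data` (W-CAFD)** — the archimedean corner data with their
reciprocal entire factor `Λ`, in the registered `∀`-closed form: `exists_archCornerFactorData`.
[cite: JacquetArchimedeanRS2009, Thm. 2.7 (i) (p. 10) and Thm. 2.1 (i) (p. 6)] -/
theorem stub_corner_arch_factor_data :
    ∀ {m : ℕ} {K : Type} [Field K] [NumberField K],
      JacquetArchimedeanRS2009_archRankinSelbergCorner_testVector m K →
    ∀ (hcpt : isCompact_glFiniteIntegralLevel (m + 1) K) (hcpt' : isCompact_glFiniteIntegralLevel m K)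
      (E : Type) [NormedAddCommGroup E] [InnerProductSpace ℂ E] [CompleteSpace E]
      (τ : ContRepresentation ℂ (AutomorphyDatum.gl (m + 1) K hcpt).arch.carrier E) (hτ : τ.IsStronglyContinuous)
      (_ : τ.IsUnitary) (_ : τ.IsTopIrreducible)
      (ℓ : archGardingSpace hcpt τ →ₗ[ℂ] ℂ) (_ : IsArchContWhittakerFunctional hcpt τ hτ ℓ) (_ : ℓ ≠ 0)
      (E' : Type) [NormedAddCommGroup E'] [InnerProductSpace ℂ E'] [CompleteSpace E']
      (τ' : ContRepresentation ℂ (AutomorphyDatum.gl m K hcpt').arch.carrier E') (hτ' : τ'.IsStronglyContinuous)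
      (_ : τ'.IsUnitary) (_ : τ'.IsTopIrreducible)
      (ℓ' : archGardingSpace hcpt' τ' →ₗ[ℂ] ℂ) (_ : IsArchContWhittakerFunctional hcpt' τ' hτ' ℓ') (_ : ℓ' ≠ 0)
      [MeasurableSpace (GL (Fin m) (mixedSpace K))] [BorelSpace (GL (Fin m) (mixedSpace K))]
      [MeasurableSpace ((mixedSpace K)ˣ)] [BorelSpace ((mixedSpace K)ˣ)]
      (μA : Measure (Fin m → (mixedSpace K)ˣ)) (_ : IsHaarMeasure μA)
      (μK : Measure ↥(Kinf m K)) (_ : IsHaarMeasure μK),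
      ∃ (k : ℕ) (e : Fin k → archGardingSpace hcpt τ) (e' : Fin k → archGardingSpace hcpt' τ')
        (_ : ∀ i, FiniteDimensional ℂ (Submodule.span ℂ (Set.range
          fun κ : (AutomorphyDatum.gl (m + 1) K hcpt).arch.maximalCompact =>
            τ (toArch hcpt (κ : GL (Fin (m + 1)) (mixedSpace K))) (e i : E))))
        (_ : ∀ i, FiniteDimensional ℂ (Submodule.span ℂ (Set.range
          fun κ : (AutomorphyDatum.gl m K hcpt').arch.maximalCompact =>
            τ' (toArch hcpt' (κ : GL (Fin m) (mixedSpace K))) (e' i : E'))))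
        (Λ : ℂ → ℂ) (x₀ : ℝ), Differentiable ℂ Λ ∧ ∀ s : ℂ, x₀ < s.re →
          Λ s * ∑ i, archCornerPairIntegralCplx hcpt hcpt' τ hτ τ' hτ' ℓ ℓ' (e i) (e' i) μA μK s = 1 := by
  intro m K _ _ h hcpt hcpt' E _ _ _ τ hτ hτu hτi ℓ hℓ hℓ0 E' _ _ _ τ' hτ' hτu' hτi' ℓ' hℓ' hℓ'0 _ _ _ _ μA hμA μK hμK
  exact exists_archCornerFactorData h hcpt hcpt' E τ hτ hτu hτi ℓ hℓ hℓ0 E' τ' hτ' hτu' hτi' ℓ' hℓ' hℓ'0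
    μA hμA μK hμK

end Summit.Langlands.Langlands.Theorems.CornerArchFactorData
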